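import Literature.MathematicalPhysics.QuantumLattice.FermionDKMSStates
import Literature.MathematicalPhysics.QuantumLattice.FermionGroundStatesGaugeOrbit
import Literature.MathematicalPhysics.QuantumLattice.InfVolFermionStateGaugeCommutator
import Literature.MathematicalPhysics.QuantumLattice.DWaveSymmetricGroundStateLRO
import HarnessLib

/-!
# Gauge covariance of the equilibrium (dKMS) states of lattice fermions; the thermal states of the Hubbard model with
# periodic boundary conditions are gauge SYMMETRIC; a superconducting order parameter in equilibrium forces a circle of
# distinct equilibrium states

Topic `Literature/MathematicalPhysics/QuantumLattice` (family `hubbard`).  The positive-temperature twin of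
`FermionGroundStatesGaugeOrbit.lean`, over the Araki–Moriya dKMS predicate `InfVolFermionState.IsDKMSState` of
`FermionDKMSStates.lean` (for `β > 0` exactly the KMS condition of the CAR-algebra dynamics, Araki–Moriya Thm. 6.4).

**What is printed.** Bratteli–Robinson II, Prop. 5.3.33: for a `*`-automorphism `α` commuting with the dynamics, `ω ∘ α` is a
`(τ, β)`-KMS state whenever `ω` is; so a unique KMS state is `α`-invariant (§5.3.1), and a `U(1)`-invariant state vanishes on
every observable of non-zero charge (§5.2.2).  Koma–Tasaki 1994, §1 and §2.4 / Cor. 2.9: the equilibrium state obtained as the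
thermodynamic limit of the Gibbs states with periodic boundary conditions is SYMMETRIC (no explicit order parameter,
`ω(c_p c_q) = 0`), while symmetry breaking — a state with `ω(P) ≠ 0` — comes with the whole orbit `ω_θ` of distinct
equilibrium states.  Here, in the energy–entropy-balance form: the three Araki–Moriya clauses of `ω ∘ γ_θ` at `(Λ, A)` are those
of `ω` at `(Λ, γ_θ A)`; and `tr(ρ_L Γ(γ_θ A)) = tr(γ_{−θ}ρ_L · ΓA) = tr(ρ_L ΓA)` for the grand-canonical density matrix
`ρ_L = e^{−βK_L}/Ξ_L`, which commutes with `N`.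

## Contents (everything PROVED; no definition, no named fact)

* §1 `InfVolFermionState.IsDKMSState.gaugeShift` — gauge transforms of dKMS states of a gauge-invariant interaction are dKMS
  states (same `β`); `IsDKMSState.isGaugeInvariant_of_unique`, `….expect_eq_zero_of_hasGaugeCharge_of_unique`,
  `….expect_cAt_mul_cAt_eq_zero_of_unique`: a UNIQUE dKMS state is gauge invariant, all anomalous amplitudes vanish in it.
* §2 FINITE VOLUME / TORUS LIMITS: `trace_mul_gaugeAut` (`tr(A·γ_θX) = tr(γ_{−θ}A·X)`), `gaugeAut_gcGibbsDensityTT'`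
  (`γ_θ ρ_L = ρ_L`), `sum_gcGibbsWeightTT'_mul_torusAvgExpectAt_gaugeAut`; `IsTorusLimitOfMixture.isGaugeInvariant` (mixtures
  of fixed-particle-number vectors, any `d`), **`IsTorusLimitOfMixture.isGaugeInvariant_of_gcGibbs`** (every thermal
  grand-canonical state of the 2D `t–t'` Hubbard model is gauge invariant — all real `β, t, t', U, μ, h`), hence
  `….expect_localPairAt_eq_zero_of_gcGibbs` / `_of_sectorGibbs` (zero pair amplitude in every PBC thermal state, grand-canonical
  or canonical) and `exists_isGaugeInvariant_isDKMSState_gcInteractionTT'` (a gauge-SYMMETRIC equilibrium state exists at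
  every `β`).
* §3 THE 2D `t–t'` HUBBARD MODEL (`gcInteractionTT'_isGaugeInvariant`): a unique equilibrium state at `(β; μ, h)` has
  `ω(P_x) = 0` for every local singlet pair and form factor (`IsDKMSState.expect_localPairAt_eq_zero_of_unique_gcTT'`); an
  equilibrium state with `ω(P_x) ≠ 0` yields the pairwise-distinct equilibrium states `ω ∘ γ_θ`, `θ ∈ [0, π)`, all dKMS at the
  same `β`, pair amplitudes `e^{−2iθ}ω(P_x)`, all inside `fermionDKMSStates` (`IsDKMSState.gaugeOrbit_gcTT'`,
  `….not_subsingleton_fermionDKMSStates_of_expect_localPairAt_ne_zero`), and such a state is NOT a thermodynamic limit of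
  PBC grand-canonical Gibbs states (`….not_isTorusLimitOfMixture_gcGibbs_of_expect_localPairAt_ne_zero`); the Hubbard
  interaction on `ℤ^d`, any `d`: `IsDKMSState.expect_cAt_mul_cAt_eq_zero_of_unique_hubbard`.

WHAT THIS IS NOT: in `d = 2` at `T > 0` translation-invariant equilibrium states have no pair amplitude at all
(`HubbardTTPrimeEquilibriumStatesNoPairing`, Mermin–Wagner–Koma–Tasaki); §1/§3 are dimension-free structural facts and say
nothing about whether symmetry-breaking equilibrium states exist.

## Mathlib / tree search

REUSED: `gaugeAut`, `fockGaugeU1`, `conjTranspose_fockGaugeU1`, `fermionEmbed_gaugeAut`, `HasGaugeCharge`,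
`hasGaugeCharge_localPairAt`, `hasGaugeCharge_annihilation_mul_annihilation` (`FockGaugeAction`); `InfVolFermionState.gaugeShift`,
`IsGaugeInvariant.expect_eq_zero_of_hasGaugeCharge`, `gaugeShift_expect_localPairAt`, `numberInteraction_isGaugeInvariant`,
`hubbardTTPrimeFermionInteraction_isGaugeInvariant` (`InfVolFermionStateGaugeAction`); `forall_gaugeAut_eq_iff_commute`
(`InfVolFermionStateGaugeCommutator`); `torusAvgExpect_gaugeAut` (`DWaveSymmetricGroundStateLRO`);
`FermionInteraction.gaugeAut_derivation`, `gaugeShift_injOn_of_expect_ne_zero` (`FermionGroundStatesGaugeOrbit`);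
`gcGibbsDensityTT'`, `commute_totalNumber_gcTorusHamiltonianTT'`, `trace_gcGibbsDensityTT'_mul_fermionEmbed_toTorusEmb`
(`HubbardTTPrimeGrandCanonicalThermalStatesEntropyRow`); `IsTorusLimitOfMixture.isDKMSState_of_gcGibbs`,
`exists_isTorusLimitOfMixture_gcGibbs_translationInvariant_isEven` (`FermionDKMSStates`, `…ThermalStatesExistence`);
`isNParticle_sectorGibbsVectorTT'` (`TorusSectorGibbsMixture`).

## References

* [BratteliRobinsonII1997] O. Bratteli, D. W. Robinson, *OAQSM 2*, 2nd ed. (1997), Prop. 5.3.33, §5.3.1, §5.2.2, Thm. 5.3.15.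
* [ArakiMoriya2003] H. Araki, H. Moriya, Rev. Math. Phys. 15 (2003) 93, Def. 6.3, Thm. 6.4, §4.1.
* [KomaTasaki1994] T. Koma, H. Tasaki, J. Stat. Phys. 76 (1994) 745–803, §1, §2.4, Cor. 2.9.
* [Tasaki2022] H. Tasaki, arXiv:2202.06243, §3 (before Cor. 3.6).
* [Israel1979] R. B. Israel, *Convexity in the Theory of Lattice Gases* (1979), §I.3 eq. (26).
-/

noncomputable section

namespace Literature.MathematicalPhysics.QuantumLattice

open _root_.Matrix Finset Complex Literature.Probability.LatticeModels HubbardWave0 ThermodynamicLimit LiebThm1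
open _root_.Filter
open scoped ComplexOrder _root_.Topology

variable {d : ℕ}

/-! ## §1 Gauge covariance of dKMS states -/

/-- **The grand-canonical `t–t'` Hubbard interaction `Φ(t,t',U) − μn − h(n↑ − n↓)` is gauge invariant** (every term conserves the
particle number). [cite: BratteliRobinsonII1997, §5.2.2] -/
theorem gcInteractionTT'_isGaugeInvariant (t t' U μ hz : ℝ) : (gcInteractionTT' t t' U μ hz).IsGaugeInvariant := by
  intro θ X
  have hs : gaugeAut θ ((spinImbalanceInteraction 2).Φ X) = (spinImbalanceInteraction 2).Φ X := by
    simp only [spinImbalanceInteraction, map_sum, apply_ite (gaugeAut θ), map_zero, map_sub, gaugeAut_nAt]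
  rw [gcInteractionTT', FermionInteraction.linearFamily_apply, map_add, map_sum, Fin.sum_univ_two, Fin.sum_univ_two,
    map_smul, map_smul, hubbardTTPrimeFermionInteraction_isGaugeInvariant t t' U θ X]
  simp only [Matrix.cons_val_zero, Matrix.cons_val_one]
  rw [numberInteraction_isGaugeInvariant θ X, hs]

namespace InfVolFermionState

variable {Ψ : FermionInteraction d} {R β : ℝ} {ω : InfVolFermionState d}

/-- **Gauge transforms of dKMS states are dKMS states** (gauge-invariant interaction, same `β`): the Araki–Moriya clauses of
`ω ∘ γ_θ` at `(Λ, A)` are those of `ω` at `(Λ, γ_θ A)` (`γ_θ` is a `*`-automorphism commuting with isotony and with `δ_Ψ`).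
[cite: BratteliRobinsonII1997, Prop. 5.3.33] [cite: ArakiMoriya2003, Def 6.3] -/
theorem IsDKMSState.gaugeShift (hΨ : Ψ.IsGaugeInvariant) (h : ω.IsDKMSState Ψ R β) (θ : ℝ) :
    (ω.gaugeShift θ).IsDKMSState Ψ R β := by
  intro Λ A
  have hA := h Λ (gaugeAut θ A)
  simp only [gaugeShift_expect, map_mul, gaugeAut_conjTranspose, ← fermionEmbed_gaugeAut,
    FermionInteraction.gaugeAut_derivation hΨ]
  exact hA

/-- The gauge orbit of a dKMS state stays inside the dKMS set. [cite: BratteliRobinsonII1997, Prop. 5.3.33] -/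
theorem IsDKMSState.mapsTo_gaugeShift_fermionDKMSStates (hΨ : Ψ.IsGaugeInvariant) (h : ω.IsDKMSState Ψ R β) :
    Set.MapsTo (fun θ : ℝ => ω.gaugeShift θ) Set.univ (fermionDKMSStates Ψ R β) :=
  fun θ _ => h.gaugeShift hΨ θ

/-- **A UNIQUE dKMS state of a gauge-invariant interaction is gauge invariant.** [cite: BratteliRobinsonII1997, §5.3.1]
[cite: Tasaki2022, §3 (before Cor. 3.6)] -/
theorem IsDKMSState.isGaugeInvariant_of_unique (hΨ : Ψ.IsGaugeInvariant) (h : ω.IsDKMSState Ψ R β)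
    (huniq : ∀ ω' : InfVolFermionState d, ω'.IsDKMSState Ψ R β → ω' = ω) : ω.IsGaugeInvariant :=
  fun θ => huniq _ (h.gaugeShift hΨ θ)

/-- **… hence every charged local observable has zero expectation in it** (no anomalous amplitude in a unique equilibrium
state). [cite: BratteliRobinsonII1997, §5.2.2] [cite: KomaTasaki1994, §2.4] -/
theorem IsDKMSState.expect_eq_zero_of_hasGaugeCharge_of_unique (hΨ : Ψ.IsGaugeInvariant) (h : ω.IsDKMSState Ψ R β)
    (huniq : ∀ ω' : InfVolFermionState d, ω'.IsDKMSState Ψ R β → ω' = ω) {Λ : Finset (Site d)} {q : ℤ} (hq : q ≠ 0)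
    {A : FermionOp Λ} (hA : HasGaugeCharge q A) : ω.expect Λ A = 0 :=
  (h.isGaugeInvariant_of_unique hΨ huniq).expect_eq_zero_of_hasGaugeCharge hq hA

/-- In particular `ω(c_{xσ} c_{yτ}) = 0` in a unique equilibrium state. [cite: BratteliRobinsonII1997, §5.2.2] -/
theorem IsDKMSState.expect_cAt_mul_cAt_eq_zero_of_unique (hΨ : Ψ.IsGaugeInvariant) (h : ω.IsDKMSState Ψ R β)
    (huniq : ∀ ω' : InfVolFermionState d, ω'.IsDKMSState Ψ R β → ω' = ω) {Λ : Finset (Site d)} {x y : Site d}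
    (hx : x ∈ Λ) (hy : y ∈ Λ) (σ τ : Fin 2) : ω.expect Λ (cAt x hx σ * cAt y hy τ) = 0 :=
  h.expect_eq_zero_of_hasGaugeCharge_of_unique hΨ huniq (by norm_num : (-2 : ℤ) ≠ 0)
    (hasGaugeCharge_annihilation_mul_annihilation _ _)

end InfVolFermionState

/-! ## §2 Gibbs states with periodic boundary conditions and their limits are gauge symmetric -/

section FiniteVolume

/-- **`tr(A · γ_θ X) = tr(γ_{−θ} A · X)`** (`γ_θ X = U X Uᴴ` with `U = e^{iθN̂}`, `Uᴴ = e^{−iθN̂}`, cyclicity of the trace).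
[cite: BratteliRobinsonII1997, §5.2.2] -/
theorem trace_mul_gaugeAut {κ : Type*} [LinearOrder κ] [Fintype κ] (A X : Matrix (Finset κ) (Finset κ) ℂ) (θ : ℝ) :
    (A * gaugeAut θ X).trace = (gaugeAut (-θ) A * X).trace := by
  rw [gaugeAut_apply, gaugeAut_apply, conjTranspose_fockGaugeU1, conjTranspose_fockGaugeU1, neg_neg, ← Matrix.mul_assoc,
    ← Matrix.mul_assoc, Matrix.trace_mul_comm (A * fockGaugeU1 θ * X) (fockGaugeU1 (-θ)), ← Matrix.mul_assoc,
    ← Matrix.mul_assoc]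

variable (L : ℕ) (β t t' U μ hz : ℝ)

/-- **The grand-canonical Gibbs density matrix is gauge invariant**: `γ_θ ρ_{L,β} = ρ_{L,β}` (`e^{−βK_L}` commutes with `N`).
[cite: BratteliRobinsonII1997, §5.2.2] [cite: Israel1979, §I.3 eq. (26)] -/
theorem gaugeAut_gcGibbsDensityTT' (θ : ℝ) : gaugeAut θ (gcGibbsDensityTT' L β t t' U μ hz) = gcGibbsDensityTT' L β t t' U μ hz := by
  refine (forall_gaugeAut_eq_iff_commute.2 ?_) θ
  rw [totalNumberOp_eq_totalNumber]
  have h1 : Commute (totalNumber : Matrix (Finset (Orb (FermionTorus 2 L))) (Finset (Orb (FermionTorus 2 L))) ℂ)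
      (-(β : ℂ) • gcTorusHamiltonianTT' L t t' U μ hz) :=
    (commute_totalNumber_gcTorusHamiltonianTT' L t t' U μ hz).smul_right _
  have h2 : Commute (totalNumber : Matrix (Finset (Orb (FermionTorus 2 L))) (Finset (Orb (FermionTorus 2 L))) ℂ)
      (gibbsWeight β (gcTorusHamiltonianTT' L t t' U μ hz)) := h1.exp_right
  rw [gcGibbsDensityTT']
  exact h2.smul_right _

/-- **The grand-canonical Gibbs mixture averages are gauge invariant**: for a region `Λ` fitting into the torus and every
`A ∈ 𝔄_Λ`, `Σ_i p_{L,i} avg_Λ(γ_θ A) ψ_{L,i} = Σ_i p_{L,i} avg_Λ(A) ψ_{L,i}` (`tr(ρ_L Γ(γ_θA)) = tr(γ_{−θ}ρ_L · ΓA)` and `ρ_L` is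
gauge invariant). [cite: BratteliRobinsonII1997, §5.2.2] [cite: KomaTasaki1994, §1] -/
theorem sum_gcGibbsWeightTT'_mul_torusAvgExpectAt_gaugeAut [NeZero L] {Λ : Finset (Site 2)}
    (hΛ : Set.InjOn (Torus.proj (d := 2) L) ↑Λ) (A : FermionOp Λ) (θ : ℝ) :
    ∑ i, (gcGibbsWeightTT' β t t' U μ hz L i : ℂ) * torusAvgExpectAt L Λ (gaugeAut θ A) (gcGibbsVectorTT' t t' U μ hz L i) =
      ∑ i, (gcGibbsWeightTT' β t t' U μ hz L i : ℂ) * torusAvgExpectAt L Λ A (gcGibbsVectorTT' t t' U μ hz L i) := by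
  rw [← trace_gcGibbsDensityTT'_mul_fermionEmbed_toTorusEmb L β t t' U μ hz hΛ,
    ← trace_gcGibbsDensityTT'_mul_fermionEmbed_toTorusEmb L β t t' U μ hz hΛ, fermionEmbed_gaugeAut, trace_mul_gaugeAut,
    gaugeAut_gcGibbsDensityTT']

end FiniteVolume

namespace InfVolFermionState

/-- **Mixture torus limits of fixed-particle-number families are gauge invariant** (each averaged component is,
`torusAvgExpect_gaugeAut`) — e.g. every torus limit of CANONICAL Gibbs states; any dimension. Twin of
`IsTorusLimitOfMixture.isEven` / `IsTorusLimitOf.isGaugeInvariant`. [cite: BratteliRobinsonII1997, §5.2.2] -/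
theorem IsTorusLimitOfMixture.isGaugeInvariant {ω : InfVolFermionState d} {m : ℕ → ℕ} {p : ∀ L, Fin (m L) → ℝ}
    {ψ : ∀ L, Fin (m L) → Fock (Orb (FermionTorus d L))} {Ls : ℕ → ℕ} (h : ω.IsTorusLimitOfMixture m p ψ Ls) {N : ℕ → ℕ}
    (hψ : ∀ L i, IsNParticle (N L) (ψ L i)) : ω.IsGaugeInvariant := by
  intro θ
  refine InfVolFermionState.ext fun Λ => LinearMap.ext fun A => ?_
  rw [InfVolFermionState.gaugeShift_expect]
  refine tendsto_nhds_unique (h Λ (gaugeAut θ A)) ?_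
  have : ∀ j, ∑ i, (p (Ls j) i : ℂ) * torusAvgExpect (Ls j) Λ (gaugeAut θ A) (ψ (Ls j) i) =
      ∑ i, (p (Ls j) i : ℂ) * torusAvgExpect (Ls j) Λ A (ψ (Ls j) i) := fun j =>
    Finset.sum_congr rfl fun i _ => by rw [torusAvgExpect_gaugeAut _ Λ A θ (hψ _ i)]
  simp_rw [this]
  exact h Λ A

variable (β t t' U μ hz : ℝ)

/-- **THERMAL GRAND-CANONICAL STATES OF THE 2D `t–t'` HUBBARD MODEL ARE GAUGE INVARIANT** (all real `β, t, t', U, μ, h`): every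
torus limit of the grand-canonical Gibbs states with periodic boundary conditions satisfies `ω ∘ γ_θ = ω` — «the equilibrium state
obtained from the periodic-b.c. Gibbs states is symmetric». [cite: KomaTasaki1994, §1] [cite: BratteliRobinsonII1997, §5.2.2] -/
theorem IsTorusLimitOfMixture.isGaugeInvariant_of_gcGibbs {ω : InfVolFermionState 2} {Ls : ℕ → ℕ}
    (hω : ω.IsTorusLimitOfMixture sourcedGibbsCount (gcGibbsWeightTT' β t t' U μ hz) (gcGibbsVectorTT' t t' U μ hz) Ls)
    (hLs : Tendsto Ls atTop atTop) : ω.IsGaugeInvariant := by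
  intro θ
  refine InfVolFermionState.ext fun Λ => LinearMap.ext fun A => ?_
  rw [InfVolFermionState.gaugeShift_expect]
  refine tendsto_nhds_unique (hω Λ (gaugeAut θ A)) ((hω Λ A).congr' ?_)
  filter_upwards [eventually_injOn_proj_of_tendsto Λ hLs, hLs.eventually_ge_atTop 1] with j hInj hj
  haveI : NeZero (Ls j) := ⟨by omega⟩
  simp_rw [torusAvgExpect_eq]
  exact (sum_gcGibbsWeightTT'_mul_torusAvgExpectAt_gaugeAut (Ls j) β t t' U μ hz hInj A θ).symm

/-- **… hence have ZERO PAIR AMPLITUDE**: `ω(P_x) = 0` for every local singlet pair `P_x = localPairAt S g x`, in every thermal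
grand-canonical state, at every temperature (no explicit superconducting order parameter in the PBC thermodynamic limit).
[cite: KomaTasaki1994, §1] [cite: BratteliRobinsonII1997, §5.2.2] -/
theorem IsTorusLimitOfMixture.expect_localPairAt_eq_zero_of_gcGibbs {ω : InfVolFermionState 2} {Ls : ℕ → ℕ}
    (hω : ω.IsTorusLimitOfMixture sourcedGibbsCount (gcGibbsWeightTT' β t t' U μ hz) (gcGibbsVectorTT' t t' U μ hz) Ls)
    (hLs : Tendsto Ls atTop atTop) (S : Finset (Site 2)) (g : Site 2 → ℝ) (x : Site 2) :
    ω.expect (pairRegion S x) (localPairAt S g x) = 0 :=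
  (hω.isGaugeInvariant_of_gcGibbs β t t' U μ hz hLs).expect_localPairAt_eq_zero S g x

/-- `ω(c_{xσ}c_{yτ}) = 0` in every thermal grand-canonical state. [cite: KomaTasaki1994, §1] [cite: BratteliRobinsonII1997, §5.2.2] -/
theorem IsTorusLimitOfMixture.expect_cAt_mul_cAt_eq_zero_of_gcGibbs {ω : InfVolFermionState 2} {Ls : ℕ → ℕ}
    (hω : ω.IsTorusLimitOfMixture sourcedGibbsCount (gcGibbsWeightTT' β t t' U μ hz) (gcGibbsVectorTT' t t' U μ hz) Ls)
    (hLs : Tendsto Ls atTop atTop) {Λ : Finset (Site 2)} {x y : Site 2} (hx : x ∈ Λ) (hy : y ∈ Λ) (σ τ : Fin 2) :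
    ω.expect Λ (cAt x hx σ * cAt y hy τ) = 0 :=
  (hω.isGaugeInvariant_of_gcGibbs β t t' U μ hz hLs).expect_eq_zero_of_hasGaugeCharge (by norm_num : (-2 : ℤ) ≠ 0)
    (hasGaugeCharge_annihilation_mul_annihilation _ _)

/-- **Canonical thermal states (torus limits of sector Gibbs states at density `n`) are gauge invariant and have zero pair
amplitude** (fixed particle number `N_L`). [cite: BratteliRobinsonII1997, §5.2.2] -/
theorem IsTorusLimitOfMixture.expect_localPairAt_eq_zero_of_sectorGibbs (n : ℝ) {ω : InfVolFermionState 2} {Ls : ℕ → ℕ}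
    (hω : ω.IsTorusLimitOfMixture (sectorGibbsCount n) (fun L => sectorGibbsWeightTT' β t t' U n L)
      (fun L => sectorGibbsVectorTT' t t' U n L) Ls) (S : Finset (Site 2)) (g : Site 2 → ℝ) (x : Site 2) :
    ω.IsGaugeInvariant ∧ ω.expect (pairRegion S x) (localPairAt S g x) = 0 :=
  have hG := hω.isGaugeInvariant fun L i => isNParticle_sectorGibbsVectorTT' t t' U n L i
  ⟨hG, hG.expect_localPairAt_eq_zero S g x⟩

/-- **A GAUGE-SYMMETRIC EQUILIBRIUM STATE EXISTS AT EVERY TEMPERATURE**: the grand-canonical `t–t'` Hubbard interaction on `ℤ²`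
has, for all real `β, μ, h`, a dKMS state at `β` that is gauge invariant, translation invariant and even (a PBC thermal state).
[cite: KomaTasaki1994, §1] [cite: ArakiMoriya2003, Def 6.3] [cite: BratteliRobinsonII1997, §5.2.2] -/
theorem exists_isGaugeInvariant_isDKMSState_gcInteractionTT' :
    ∃ ω : InfVolFermionState 2, ω.IsDKMSState (gcInteractionTT' t t' U μ hz) 1 β ∧ ω.IsGaugeInvariant ∧
      ω.IsTranslationInvariant ∧ ω.IsEven := by
  obtain ⟨Ls, ω, hLs, hω, hTI, hEv⟩ := exists_isTorusLimitOfMixture_gcGibbs_translationInvariant_isEven β t t' U μ hz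
  exact ⟨ω, hω.isDKMSState_of_gcGibbs t t' U μ hz hLs, hω.isGaugeInvariant_of_gcGibbs β t t' U μ hz hLs, hTI, hEv⟩

end InfVolFermionState

/-! ## §3 The Hubbard model: uniqueness versus a superconducting order parameter -/

namespace InfVolFermionState

/-- **A UNIQUE EQUILIBRIUM STATE OF THE 2D `t–t'` HUBBARD MODEL HAS ZERO PAIR AMPLITUDE**: if the grand-canonical interaction
`gcInteractionTT' t t' U μ h` has exactly one dKMS state `ω` at `β` (range parameter `R`), then `ω(P_x) = 0` for every local singlet
pair `P_x = localPairAt S g x` — a superconducting order parameter in equilibrium requires phase coexistence.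
[cite: BratteliRobinsonII1997, Prop. 5.3.33, §5.2.2] [cite: KomaTasaki1994, §2.4] -/
theorem IsDKMSState.expect_localPairAt_eq_zero_of_unique_gcTT' {t t' U μ hz R β : ℝ} {ω : InfVolFermionState 2}
    (h : ω.IsDKMSState (gcInteractionTT' t t' U μ hz) R β)
    (huniq : ∀ ω' : InfVolFermionState 2, ω'.IsDKMSState (gcInteractionTT' t t' U μ hz) R β → ω' = ω)
    (S : Finset (Site 2)) (g : Site 2 → ℝ) (x : Site 2) : ω.expect (pairRegion S x) (localPairAt S g x) = 0 :=
  h.expect_eq_zero_of_hasGaugeCharge_of_unique (gcInteractionTT'_isGaugeInvariant t t' U μ hz) huniq (by norm_num)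
    (hasGaugeCharge_localPairAt S g x)

/-- If the equilibrium state at `β` (range `1`) is unique, it IS the PBC thermal state: every torus limit of grand-canonical
Gibbs states equals it. [cite: BratteliRobinsonII1997, §5.3.1] -/
theorem IsDKMSState.eq_of_unique_of_isTorusLimitOfMixture_gcGibbs {t t' U μ hz β : ℝ} {ω ω' : InfVolFermionState 2} {Ls : ℕ → ℕ}
    (huniq : ∀ ω'' : InfVolFermionState 2, ω''.IsDKMSState (gcInteractionTT' t t' U μ hz) 1 β → ω'' = ω)
    (hω' : ω'.IsTorusLimitOfMixture sourcedGibbsCount (gcGibbsWeightTT' β t t' U μ hz) (gcGibbsVectorTT' t t' U μ hz) Ls)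
    (hLs : Tendsto Ls atTop atTop) : ω' = ω :=
  huniq ω' (hω'.isDKMSState_of_gcGibbs t t' U μ hz hLs)

/-- **… for the Hubbard interaction on `ℤ^d` (any `d`)**: a unique dKMS state has `ω(c_{xσ}c_{yτ}) = 0`.
[cite: BratteliRobinsonII1997, Prop. 5.3.33, §5.2.2] -/
theorem IsDKMSState.expect_cAt_mul_cAt_eq_zero_of_unique_hubbard {t U R β : ℝ} {ω : InfVolFermionState d}
    (h : ω.IsDKMSState (hubbardFermionInteraction d t U) R β)
    (huniq : ∀ ω' : InfVolFermionState d, ω'.IsDKMSState (hubbardFermionInteraction d t U) R β → ω' = ω)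
    {Λ : Finset (Site d)} {x y : Site d} (hx : x ∈ Λ) (hy : y ∈ Λ) (σ τ : Fin 2) :
    ω.expect Λ (cAt x hx σ * cAt y hy τ) = 0 :=
  h.expect_cAt_mul_cAt_eq_zero_of_unique (hubbardFermionInteraction_isGaugeInvariant t U) huniq hx hy σ τ

/-- **THE GAUGE ORBIT OF A SYMMETRY-BREAKING EQUILIBRIUM STATE OF THE `t–t'` HUBBARD MODEL**: a dKMS state `ω` at `β` with a
nonzero pair amplitude `ω(P_x) ≠ 0` comes with the dKMS states `ω ∘ γ_θ` at `β`, pair amplitudes `e^{−2iθ}ω(P_x)`, pairwise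
distinct for `θ ∈ [0, π)` — a continuum of coexisting equilibrium states. [cite: KomaTasaki1994, Cor. 2.9, §2.4]
[cite: BratteliRobinsonII1997, Prop. 5.3.33, §5.2.2] -/
theorem IsDKMSState.gaugeOrbit_gcTT' {t t' U μ hz R β : ℝ} {ω : InfVolFermionState 2}
    (h : ω.IsDKMSState (gcInteractionTT' t t' U μ hz) R β) {S : Finset (Site 2)} {g : Site 2 → ℝ} {x : Site 2}
    (hne : ω.expect (pairRegion S x) (localPairAt S g x) ≠ 0) :
    (∀ θ : ℝ, (ω.gaugeShift θ).IsDKMSState (gcInteractionTT' t t' U μ hz) R β ∧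
      (ω.gaugeShift θ).expect (pairRegion S x) (localPairAt S g x) =
        Complex.exp (-(2 * (I * θ))) * ω.expect (pairRegion S x) (localPairAt S g x)) ∧
    Set.InjOn (fun θ : ℝ => ω.gaugeShift θ) (Set.Ico 0 Real.pi) := by
  refine ⟨fun θ => ⟨h.gaugeShift (gcInteractionTT'_isGaugeInvariant t t' U μ hz) θ, ω.gaugeShift_expect_localPairAt θ S g x⟩, ?_⟩
  have hinj := gaugeShift_injOn_of_expect_ne_zero (ω := ω) (by norm_num : (-2 : ℤ) ≠ 0) (hasGaugeCharge_localPairAt S g x) hne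
  have hI : Set.Ico 0 Real.pi = Set.Ico 0 (2 * Real.pi / |((-2 : ℤ) : ℝ)|) := by
    congr 1
    push_cast
    rw [abs_neg, abs_two]
    ring
  rw [hI]
  exact hinj

/-- **… so the set of equilibrium states at `β` is not a singleton** (it contains the injective image of `[0, π)`).
[cite: KomaTasaki1994, §2.4] -/
theorem IsDKMSState.not_subsingleton_fermionDKMSStates_of_expect_localPairAt_ne_zero {t t' U μ hz R β : ℝ}
    {ω : InfVolFermionState 2} (h : ω.IsDKMSState (gcInteractionTT' t t' U μ hz) R β) {S : Finset (Site 2)} {g : Site 2 → ℝ}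
    {x : Site 2} (hne : ω.expect (pairRegion S x) (localPairAt S g x) ≠ 0) :
    ¬ (fermionDKMSStates (gcInteractionTT' t t' U μ hz) R β).Subsingleton := by
  intro hsub
  obtain ⟨horb, hinj⟩ := h.gaugeOrbit_gcTT' hne
  have h0 : (0 : ℝ) ∈ Set.Ico 0 Real.pi := ⟨le_rfl, Real.pi_pos⟩
  have h1 : Real.pi / 2 ∈ Set.Ico 0 Real.pi := ⟨by positivity, by linarith [Real.pi_pos]⟩
  have heq : ω.gaugeShift 0 = ω.gaugeShift (Real.pi / 2) := hsub (horb 0).1 (horb (Real.pi / 2)).1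
  have := hinj h0 h1 heq
  linarith [Real.pi_pos]

/-- **… and such a state is NOT a thermodynamic limit of periodic-b.c. grand-canonical Gibbs states** (those are gauge
invariant, `IsTorusLimitOfMixture.isGaugeInvariant_of_gcGibbs`): symmetry-breaking equilibrium states, if any, arise only from
other boundary conditions / symmetry-breaking fields / decompositions. [cite: KomaTasaki1994, §1] -/
theorem not_isTorusLimitOfMixture_gcGibbs_of_expect_localPairAt_ne_zero {β' t t' U μ hz : ℝ} {ω : InfVolFermionState 2}
    {S : Finset (Site 2)} {g : Site 2 → ℝ} {x : Site 2} (hne : ω.expect (pairRegion S x) (localPairAt S g x) ≠ 0)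
    {Ls : ℕ → ℕ} (hLs : Tendsto Ls atTop atTop) :
    ¬ ω.IsTorusLimitOfMixture sourcedGibbsCount (gcGibbsWeightTT' β' t t' U μ hz) (gcGibbsVectorTT' t t' U μ hz) Ls :=
  fun hω => hne (hω.expect_localPairAt_eq_zero_of_gcGibbs β' t t' U μ hz hLs S g x)

/-- **DICHOTOMY at each `(β; t, t', U, μ, h)`** for the equilibrium states of range `1`: EITHER every dKMS state has zero pair
amplitude on every local singlet pair, OR the dKMS set contains, besides the gauge-symmetric PBC thermal state, a circle
`{ω ∘ γ_θ}` of pairwise-distinct symmetry-breaking dKMS states — in particular it is then not a singleton.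
[cite: KomaTasaki1994, §1, §2.4, Cor. 2.9] [cite: BratteliRobinsonII1997, Prop. 5.3.33] -/
theorem dKMSStates_gcTT'_pairing_dichotomy (t t' U μ hz β : ℝ) :
    (∀ ω ∈ fermionDKMSStates (gcInteractionTT' t t' U μ hz) 1 β, ∀ (S : Finset (Site 2)) (g : Site 2 → ℝ) (x : Site 2),
        ω.expect (pairRegion S x) (localPairAt S g x) = 0) ∨
      ((∃ ω₀ ∈ fermionDKMSStates (gcInteractionTT' t t' U μ hz) 1 β, ω₀.IsGaugeInvariant) ∧
        ∃ ω ∈ fermionDKMSStates (gcInteractionTT' t t' U μ hz) 1 β, ¬ ω.IsGaugeInvariant ∧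
          (∀ θ : ℝ, ω.gaugeShift θ ∈ fermionDKMSStates (gcInteractionTT' t t' U μ hz) 1 β) ∧
          Set.InjOn (fun θ : ℝ => ω.gaugeShift θ) (Set.Ico 0 Real.pi)) := by
  by_cases hall : ∀ ω ∈ fermionDKMSStates (gcInteractionTT' t t' U μ hz) 1 β, ∀ (S : Finset (Site 2)) (g : Site 2 → ℝ)
      (x : Site 2), ω.expect (pairRegion S x) (localPairAt S g x) = 0
  · exact Or.inl hall
  · right
    push Not at hall
    obtain ⟨ω, hω, S, g, x, hne⟩ := hall
    obtain ⟨ω₀, hω₀, hG₀, -, -⟩ := exists_isGaugeInvariant_isDKMSState_gcInteractionTT' β t t' U μ hz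
    obtain ⟨horb, hinj⟩ := IsDKMSState.gaugeOrbit_gcTT' (R := 1) hω hne
    refine ⟨⟨ω₀, hω₀, hG₀⟩, ω, hω, fun hG => hne (hG.expect_localPairAt_eq_zero S g x), fun θ => (horb θ).1, hinj⟩

end InfVolFermionState

end Literature.MathematicalPhysics.QuantumLattice

end
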